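import Literature.Topology.FourManifolds.FrameAlongLoopOrientation
import Literature.Geometry.Symplectic.NearSymplecticPullbackTransport
import Literature.Geometry.Symplectic.SymplecticOrientation
import Literature.Geometry.Symplectic.AxisGluingPrimitive
import Literature.Geometry.Symplectic.ZeroCircleGradientFamily
import Mathlib.Tactic.Module
import HarnessLib

/-!
# The orientation sign of a tubular chart is constant along the tube

Topic `Geometry/Symplectic`; namespace `Literature.Geometry.Symplectic`.  Theorems only; no named
fact, no `sorry`.  For an immersion `χ` of the model tube `hondaTube r ⊆ ℝ⁴` into an oriented
`4`-manifold `(M, o)`, smooth on the tube, the predicate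

`o(χ q) = signOrientationIn 4 (det dχ_q)` ("`χ` is orientation preserving at `q`", the
differential read in the preferred chart at `χ q`)

is constant on the (convex, hence connected) tube (`tubeChart_orientation_iff`): it is the
orientation sign of the continuous frame `dχ_q(eᵢ)` of `TM` along any segment of the tube, which
is locally constant (`frameOrientation_iff_eventually`, Lee 2013, Ch. 15).  Consequences used by
the gluing along an even zero circle (Perutz 2006, Lemma 3.1): the sign is fixed by a positive
zero on the axis (`orientation_axis_of_isPositiveZero`), and at every point of the tube a
`2`-form `ω` on `T_{χ q}M` whose pull-back `dχ_q^*ω` has positive Pfaffian is positive for `o`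
(`tubeChart_orientation_of_isPositiveZero`).

## References

* J. M. Lee, *Introduction to Smooth Manifolds*, 2nd ed. (2013), Ch. 15, pp. 380–383.
  [LeeSmoothManifolds2013]
* T. Perutz, *Zero-sets of near-symplectic forms*, J. Symplectic Geom. 4 (2006), Lemma 3.1.
  [Perutz2006]
-/

noncomputable section

open scoped Manifold ContDiff Topology Real
open Set Function Filter Module Bundle Literature.Topology.FourManifolds Literature.Geometry.Kaehler

namespace Literature.Geometry.Symplectic

universe u

/-! ### Locally constant predicates on `ℝ` -/

/-- A predicate on `ℝ` which is locally constant is constant. [folklore] -/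
theorem iff_of_eventually_iff {S : Set ℝ} (hloc : ∀ t₀, ∀ᶠ t in 𝓝 t₀, (t ∈ S ↔ t₀ ∈ S))
    (t t' : ℝ) : t ∈ S ↔ t' ∈ S := by
  have hopen : IsOpen S := isOpen_iff_mem_nhds.2 fun t₀ ht₀ ↦
    (hloc t₀).mono fun t ht ↦ ht.2 ht₀
  have hclosed : IsOpen Sᶜ := isOpen_iff_mem_nhds.2 fun t₀ ht₀ ↦
    (hloc t₀).mono fun t ht h ↦ ht₀ (ht.1 h)
  have hclopen : IsClopen S := ⟨⟨hclosed⟩, hopen⟩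
  rcases isClopen_iff.1 hclopen with h | h <;> simp [h]

/-! ### Sign orientations of frames `A eᵢ` -/

/-- **The orientation of the frame `(A eᵢ)` is the sign orientation of `det A`** (standard
basis reindexed as in `euclideanOrientation`). [folklore] -/
theorem basis_map_orientation_eq_signOrientationIn
    (A : EuclideanSpace ℝ (Fin 4) ≃ₗ[ℝ] EuclideanSpace ℝ (Fin 4)) :
    (((EuclideanSpace.basisFun (Fin 4) ℝ).toBasis.reindex
        (finCongr (finrank_euclideanSpace_fin (𝕜 := ℝ) (n := 4)).symm)).map A).orientation =
      signOrientationIn 4 (LinearMap.det (A : EuclideanSpace ℝ (Fin 4) →ₗ[ℝ] EuclideanSpace ℝ (Fin 4))) := by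
  have hb : ((EuclideanSpace.basisFun (Fin 4) ℝ).toBasis.reindex
      (finCongr (finrank_euclideanSpace_fin (𝕜 := ℝ) (n := 4)).symm)).orientation = euclideanOrientation 4 := rfl
  have hcard : Fintype.card (Fin (finrank ℝ (EuclideanSpace ℝ (Fin 4)))) =
      finrank ℝ (EuclideanSpace ℝ (Fin 4)) := Fintype.card_fin _
  rw [Basis.orientation_map, hb]
  unfold signOrientationIn
  by_cases hdet : 0 < LinearMap.det (A : EuclideanSpace ℝ (Fin 4) →ₗ[ℝ] EuclideanSpace ℝ (Fin 4))
  · rw [if_pos hdet]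
    exact (Orientation.map_eq_iff_det_pos _ A hcard).2 hdet
  · rw [if_neg hdet]
    have hne : LinearMap.det (A : EuclideanSpace ℝ (Fin 4) →ₗ[ℝ] EuclideanSpace ℝ (Fin 4)) ≠ 0 :=
      (LinearEquiv.isUnit_det' A).ne_zero
    exact (Orientation.map_eq_neg_iff_det_neg _ A hcard).2 (lt_of_le_of_ne (not_lt.1 hdet) hne)

/-- The orientation of a basis whose vectors are `A eᵢ` for an injective endomorphism `A`.
[folklore] -/
theorem basis_orientation_eq_signOrientationIn_of_injective
    {A : EuclideanSpace ℝ (Fin 4) →L[ℝ] EuclideanSpace ℝ (Fin 4)} (hA : Injective A)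
    {B : Basis (Fin (finrank ℝ (EuclideanSpace ℝ (Fin 4)))) ℝ (EuclideanSpace ℝ (Fin 4))}
    (hB : ⇑B = fun i ↦ A (((EuclideanSpace.basisFun (Fin 4) ℝ).toBasis.reindex
      (finCongr (finrank_euclideanSpace_fin (𝕜 := ℝ) (n := 4)).symm)) i)) :
    B.orientation = signOrientationIn 4
      (LinearMap.det (A : EuclideanSpace ℝ (Fin 4) →ₗ[ℝ] EuclideanSpace ℝ (Fin 4))) := by
  set A' : EuclideanSpace ℝ (Fin 4) ≃ₗ[ℝ] EuclideanSpace ℝ (Fin 4) :=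
    LinearEquiv.ofInjectiveEndo (A : EuclideanSpace ℝ (Fin 4) →ₗ[ℝ] EuclideanSpace ℝ (Fin 4)) hA
    with hA'
  have hcoe : (A' : EuclideanSpace ℝ (Fin 4) →ₗ[ℝ] EuclideanSpace ℝ (Fin 4)) = A :=
    LinearMap.ext fun v ↦ rfl
  have hBmap : B = ((EuclideanSpace.basisFun (Fin 4) ℝ).toBasis.reindex
      (finCongr (finrank_euclideanSpace_fin (𝕜 := ℝ) (n := 4)).symm)).map A' :=
    Basis.eq_of_apply_eq fun i ↦ by rw [Basis.map_apply, hB]; rfl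
  rw [hBmap, basis_map_orientation_eq_signOrientationIn, hcoe]

/-- Sign comparison through a pull-back with positive Pfaffian: if `Pf(A^*ω) > 0` then
`o x = signOrientationIn (Pf Ω)` iff `o x = signOrientationIn (det A)`. [folklore] -/
theorem eq_signOrientationIn_pfaffian_iff {α : Type*} (o : α)
    (f : α → _root_.Orientation ℝ (EuclideanSpace ℝ (Fin 4)) (Fin (finrank ℝ (EuclideanSpace ℝ (Fin 4)))))
    (A : EuclideanSpace ℝ (Fin 4) →L[ℝ] EuclideanSpace ℝ (Fin 4))
    (Ω : (EuclideanSpace ℝ (Fin 4)) [⋀^Fin 2]→L[ℝ] ℝ)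
    (hΩ : 0 < pfaffian (Ω.compContinuousLinearMap A)) :
    f o = signOrientationIn 4 (pfaffian Ω) ↔
      f o = signOrientationIn 4
        (LinearMap.det (A : EuclideanSpace ℝ (Fin 4) →ₗ[ℝ] EuclideanSpace ℝ (Fin 4))) := by
  rw [pfaffian_compContinuousLinearMap] at hΩ
  have key : signOrientationIn 4 (pfaffian Ω) = signOrientationIn 4
      (LinearMap.det (A : EuclideanSpace ℝ (Fin 4) →ₗ[ℝ] EuclideanSpace ℝ (Fin 4))) :=
    signOrientationIn_eq_iff.2 (pos_iff_pos_of_mul_pos hΩ).symm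
  rw [key]

/-! ### Frames along paths in the tube -/

variable {M : Type u} [TopologicalSpace M] [ChartedSpace (EuclideanSpace ℝ (Fin 4)) M]
  [IsManifold (𝓡 4) ∞ M]

/-- **Continuity in `TM` of `t ↦ dχ_{p(t)}(v)`** along a continuous path `p` in an open set on
which `χ` is smooth (`ContMDiffOn.continuousOn_tangentMapWithin`). [folklore] -/
theorem continuous_mfderiv_section {χ : EuclideanSpace ℝ (Fin 4) → M}
    {s : Set (EuclideanSpace ℝ (Fin 4))} (hs : IsOpen s)
    (hχs : ContMDiffOn 𝓘(ℝ, EuclideanSpace ℝ (Fin 4)) (𝓡 4) ∞ χ s)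
    {p : ℝ → EuclideanSpace ℝ (Fin 4)} (hp : Continuous p) (hpt : ∀ t, p t ∈ s)
    (v : EuclideanSpace ℝ (Fin 4)) :
    Continuous fun t ↦ (TotalSpace.mk' (EuclideanSpace ℝ (Fin 4)) (χ (p t))
      (mfderiv 𝓘(ℝ, EuclideanSpace ℝ (Fin 4)) (𝓡 4) χ (p t) v) : TangentBundle (𝓡 4) M) := by
  have h1 : ContinuousOn (tangentMapWithin 𝓘(ℝ, EuclideanSpace ℝ (Fin 4)) (𝓡 4) χ s)
      (TotalSpace.proj ⁻¹' s) :=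
    hχs.continuousOn_tangentMapWithin (by simp) hs.uniqueMDiffOn
  have h2 : Continuous fun t : ℝ ↦ (TotalSpace.mk' (EuclideanSpace ℝ (Fin 4)) (p t) v :
      TangentBundle 𝓘(ℝ, EuclideanSpace ℝ (Fin 4)) (EuclideanSpace ℝ (Fin 4))) := by
    have : Continuous ((tangentBundleModelSpaceHomeomorph 𝓘(ℝ, EuclideanSpace ℝ (Fin 4))).symm ∘
        fun t ↦ (p t, v)) := (Homeomorph.continuous _).comp (by fun_prop)
    exact this
  have h3 := h1.comp_continuous h2 fun t ↦ hpt t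
  refine h3.congr fun t ↦ ?_
  simp only [Function.comp_apply, tangentMapWithin]
  rw [mfderivWithin_of_mem_nhds (hs.mem_nhds (hpt t))]

omit [IsManifold (𝓡 4) ∞ M] in
/-- The frame `dχ_q(eᵢ)` of an immersion is linearly independent. [folklore] -/
theorem linearIndependent_mfderiv_basis {χ : EuclideanSpace ℝ (Fin 4) → M}
    {q : EuclideanSpace ℝ (Fin 4)}
    (hinj : Injective (mfderiv 𝓘(ℝ, EuclideanSpace ℝ (Fin 4)) (𝓡 4) χ q)) :
    LinearIndependent ℝ fun i ↦ (mfderiv 𝓘(ℝ, EuclideanSpace ℝ (Fin 4)) (𝓡 4) χ q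
      (((EuclideanSpace.basisFun (Fin 4) ℝ).toBasis.reindex
        (finCongr (finrank_euclideanSpace_fin (𝕜 := ℝ) (n := 4)).symm)) i) : EuclideanSpace ℝ (Fin 4)) := by
  have hb := ((EuclideanSpace.basisFun (Fin 4) ℝ).toBasis.reindex
    (finCongr (finrank_euclideanSpace_fin (𝕜 := ℝ) (n := 4)).symm)).linearIndependent
  exact hb.map' ((flatDifferential χ q : EuclideanSpace ℝ (Fin 4) →L[ℝ] EuclideanSpace ℝ (Fin 4)) :
    EuclideanSpace ℝ (Fin 4) →ₗ[ℝ] EuclideanSpace ℝ (Fin 4)) (LinearMap.ker_eq_bot.2 hinj)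

/-- **The orientation sign of a tubular immersion is constant on the tube** (Lee 2013,
Ch. 15: pointwise orientations of a continuous frame are locally constant; the tube is convex).
[cite: LeeSmoothManifolds2013, Ch. 15] -/
theorem tubeChart_orientation_iff (o : SmoothOrientation (𝓡 4) M)
    {χ : EuclideanSpace ℝ (Fin 4) → M} {r : ℝ}
    (hχs : ContMDiffOn 𝓘(ℝ, EuclideanSpace ℝ (Fin 4)) (𝓡 4) ∞ χ (hondaTube r))
    (hχimm : ∀ q ∈ hondaTube r, Injective (mfderiv 𝓘(ℝ, EuclideanSpace ℝ (Fin 4)) (𝓡 4) χ q))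
    {q q' : EuclideanSpace ℝ (Fin 4)} (hq : q ∈ hondaTube r) (hq' : q' ∈ hondaTube r) :
    (o (χ q) = signOrientationIn 4 (LinearMap.det
      (flatDifferential χ q : EuclideanSpace ℝ (Fin 4) →ₗ[ℝ] EuclideanSpace ℝ (Fin 4)))) ↔
    (o (χ q') = signOrientationIn 4 (LinearMap.det
      (flatDifferential χ q' : EuclideanSpace ℝ (Fin 4) →ₗ[ℝ] EuclideanSpace ℝ (Fin 4)))) := by
  classical
  -- the segment from `q'` to `q`, clamped, as a path on `ℝ`
  set p : ℝ → EuclideanSpace ℝ (Fin 4) := fun t ↦ q' + (projIcc (0 : ℝ) 1 zero_le_one t : ℝ) • (q - q')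
    with hp
  have hpc : Continuous p := by
    have : Continuous fun t : ℝ ↦ ((projIcc (0 : ℝ) 1 zero_le_one t : ℝ)) :=
      continuous_subtype_val.comp continuous_projIcc
    simp only [hp]
    fun_prop
  have hpt : ∀ t, p t ∈ hondaTube r := by
    intro t
    have hs : (projIcc (0 : ℝ) 1 zero_le_one t : ℝ) ∈ Icc (0 : ℝ) 1 := (projIcc 0 1 zero_le_one t).2
    have hmem := (convex_hondaTube r) hq' hq (sub_nonneg.2 hs.2) hs.1 (sub_add_cancel 1 _)
    have heq : p t = (1 - (projIcc (0 : ℝ) 1 zero_le_one t : ℝ)) • q' +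
        (projIcc (0 : ℝ) 1 zero_le_one t : ℝ) • q := by
      simp only [hp]
      module
    rw [heq]
    exact hmem
  have hp0 : p 0 = q' := by simp [hp, projIcc_left]
  have hp1 : p 1 = q := by simp [hp, projIcc_right]
  -- the frame `dχ_{p t}(eᵢ)`
  set b₀ := (EuclideanSpace.basisFun (Fin 4) ℝ).toBasis.reindex
    (finCongr (finrank_euclideanSpace_fin (𝕜 := ℝ) (n := 4)).symm) with hb₀
  set f : ℝ → Fin (finrank ℝ (EuclideanSpace ℝ (Fin 4))) → EuclideanSpace ℝ (Fin 4) :=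
    fun t i ↦ mfderiv 𝓘(ℝ, EuclideanSpace ℝ (Fin 4)) (𝓡 4) χ (p t) (b₀ i) with hf
  have hfc : ∀ i, Continuous fun t ↦ (TotalSpace.mk' (EuclideanSpace ℝ (Fin 4)) (χ (p t)) (f t i) :
      TangentBundle (𝓡 4) M) := fun i ↦
    continuous_mfderiv_section (isOpen_hondaTube r) hχs hpc hpt (b₀ i)
  have hli : ∀ t, LinearIndependent ℝ (f t) := fun t ↦
    linearIndependent_mfderiv_basis (hχimm _ (hpt t))
  have hn : 0 < finrank ℝ (EuclideanSpace ℝ (Fin 4)) := by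
    rw [finrank_euclideanSpace_fin]; norm_num
  choose B hB using exists_basis_of_frame hn hli
  -- local constancy of the orientation sign along the path, hence constancy
  set S : Set ℝ := {t | (B t).orientation = o (χ (p t))} with hS
  have hloc : ∀ t₀, ∀ᶠ t in 𝓝 t₀, (t ∈ S ↔ t₀ ∈ S) := fun t₀ ↦
    frameOrientation_iff_eventually (γ := χ ∘ p) o hn hfc B hB t₀
  have hiff := iff_of_eventually_iff hloc 1 0
  -- translate the frame orientation into the sign orientation of `det dχ`
  have hBo : ∀ t, (B t).orientation = signOrientationIn 4 (LinearMap.det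
      (flatDifferential χ (p t) : EuclideanSpace ℝ (Fin 4) →ₗ[ℝ] EuclideanSpace ℝ (Fin 4))) := fun t ↦
    basis_orientation_eq_signOrientationIn_of_injective (A := flatDifferential χ (p t))
      (hχimm _ (hpt t)) ((hB t).trans (funext fun i ↦ rfl))
  simp only [hS, mem_setOf_eq, hBo, hp0, hp1] at hiff
  constructor
  · intro h; exact (hiff.1 h.symm).symm
  · intro h; exact (hiff.2 h.symm).symm

/-! ### The sign is fixed by a positive zero on the axis -/

/-- **At a positive zero the chart is `o`-compatible**: if `sf(χ q) = 0` is a positive zero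
for `o` and some gradient value of `χ^*sf` at `q` has positive Pfaffian, then
`o(χ q) = signOrientationIn (det dχ_q)`. [cite: Perutz2006, Def. 1.1 and Lemma 2.1] -/
theorem orientation_axis_of_isPositiveZero {o : SmoothOrientation (𝓡 4) M}
    {sf : MForm (𝓡 4) M ℝ 2} {χ : EuclideanSpace ℝ (Fin 4) → M} {q : EuclideanSpace ℝ (Fin 4)}
    (hχ : ∀ᶠ z in 𝓝 q, ContMDiffAt 𝓘(ℝ, EuclideanSpace ℝ (Fin 4)) (𝓡 4) ∞ χ z)
    (hsf : sf.SmoothAt (χ q)) (h0 : sf (χ q) = 0) (hpz : IsPositiveZero o sf (χ q))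
    {W : EuclideanSpace ℝ (Fin 4)}
    (hW : 0 < pfaffian (zeroGradient (sf.pullback 𝓘(ℝ, EuclideanSpace ℝ (Fin 4)) χ) q W)) :
    o (χ q) = signOrientationIn 4 (LinearMap.det
      (flatDifferential χ q : EuclideanSpace ℝ (Fin 4) →ₗ[ℝ] EuclideanSpace ℝ (Fin 4))) := by
  rw [zeroGradient_pullback_eq_comp hχ hsf h0 W] at hW
  have hne : zeroGradient sf (χ q) (flatDifferential χ q W) ≠ 0 := by
    intro h
    rw [h] at hW
    have h0' : (0 : (EuclideanSpace ℝ (Fin 4)) [⋀^Fin 2]→L[ℝ] ℝ).compContinuousLinearMap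
        (flatDifferential χ q) = 0 := by ext v; rfl
    rw [h0', pfaffian_zero] at hW
    exact lt_irrefl _ hW
  obtain ⟨-, hsign⟩ := hpz.2 _ hne
  exact (eq_signOrientationIn_pfaffian_iff (χ q) o (flatDifferential χ q) _ hW).1 hsign

/-- **Positivity transport along a tubular chart** (the orientation bookkeeping of Perutz 2006,
Lemma 3.1): let `χ` be an immersion of `hondaTube r` into `(M, o)`, smooth on the tube, let
`sf(χ(θe₀)) = 0` be a positive zero of `sf` with some gradient value of `χ^*sf` of positive
Pfaffian there; then at every `q` of the tube, every `2`-form `ω` on `T_{χ q}M` with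
`Pf(dχ_q^*ω) > 0` satisfies `o(χ q) = signOrientationIn (Pf ω)`. [cite: Perutz2006, Lemma 3.1 (proof)] -/
theorem tubeChart_orientation_of_isPositiveZero (o : SmoothOrientation (𝓡 4) M)
    {sf : MForm (𝓡 4) M ℝ 2} {χ : EuclideanSpace ℝ (Fin 4) → M} {r : ℝ} (hr : 0 < r)
    (hχs : ContMDiffOn 𝓘(ℝ, EuclideanSpace ℝ (Fin 4)) (𝓡 4) ∞ χ (hondaTube r))
    (hχimm : ∀ q ∈ hondaTube r, Injective (mfderiv 𝓘(ℝ, EuclideanSpace ℝ (Fin 4)) (𝓡 4) χ q))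
    (hsm : IsSmoothForm sf) {θ : ℝ} (h0 : sf (χ (hondaAxisPoint θ)) = 0)
    (hpz : IsPositiveZero o sf (χ (hondaAxisPoint θ))) {W : EuclideanSpace ℝ (Fin 4)}
    (hW : 0 < pfaffian (zeroGradient (sf.pullback 𝓘(ℝ, EuclideanSpace ℝ (Fin 4)) χ)
      (hondaAxisPoint θ) W))
    {q : EuclideanSpace ℝ (Fin 4)} (hq : q ∈ hondaTube r)
    (Ω : (EuclideanSpace ℝ (Fin 4)) [⋀^Fin 2]→L[ℝ] ℝ)
    (hΩ : 0 < pfaffian (Ω.compContinuousLinearMap (flatDifferential χ q))) :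
    o (χ q) = signOrientationIn 4 (pfaffian Ω) := by
  have ha : hondaAxisPoint θ ∈ hondaTube r := hondaAxisPoint_mem_hondaTube hr θ
  have hχ : ∀ᶠ z in 𝓝 (hondaAxisPoint θ),
      ContMDiffAt 𝓘(ℝ, EuclideanSpace ℝ (Fin 4)) (𝓡 4) ∞ χ z :=
    eventually_contMDiffAt_of_mem_hondaTube hχs ha
  have hbase := orientation_axis_of_isPositiveZero hχ (hsm _) h0 hpz hW
  have hq' := (tubeChart_orientation_iff o hχs hχimm hq ha).2 hbase
  exact (eq_signOrientationIn_pfaffian_iff (χ q) o _ Ω hΩ).2 hq'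

end Literature.Geometry.Symplectic

end
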